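import Summits.Ventures.LatticeQCDFlow.Exactness.DoeblinAutocovariance
import Summits.Ventures.LatticeQCDFlow.Scoring.CalibrationTruths
import HarnessLib

/-!
# The integrated autocorrelation time of every event is finite under a Doeblin chain — in the scorers' own `τ_int`

HONEST FRAMING: exact (Metropolis-corrected) sampling algorithms for lattice gauge theory;
figures of merit are autocorrelation/cost numbers at stated couplings and volumes; no
continuum-physics claim.

Venture `LatticeQCDFlow` (cell pub-lqcd), topic `Exactness`, FANOUT row 9 (eng-latcore, the
engine `latflow.core`).  NEW WORK of the cell, composing row 9's `DoeblinAutocovariance.lean`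
(`|C_t(A, B)| ≤ π(A)(1 − ε)ᵗ` in equilibrium) with the scorers' definition of the integrated
autocorrelation time `Scoring.tauInt ρ = 1/2 + Σ_{t≥1} ρ t` (`Scoring/CalibrationTruths.lean`,
Madras–Sokal / Wolff convention, the FITNESS τ_int).  Nothing is cited as a fact.  Printed
counterpart, NAMED ONLY: Sokal 1997 §2 (`τ_int ≤ τ_exp`-type bounds).

## What is proved (general measurable state space; Markov kernel `κ` with `κ(x,·) ≥ ε ν`, invariant probability `π`)

* `setAutocov_zero` — `C_0(A, A) = π(A)(1 − π(A))` (the variance of the indicator);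
  `setACF κ π A t = C_t(A,A)/C_0(A,A)` — the normalised autocorrelation function of the event `A`
  for the chain in equilibrium (what the scorers estimate from a chain for a sector indicator).
* **`abs_setACF_le`** — `|ρ_A(t)| ≤ (1 − ε)ᵗ/(1 − π(A))` (`0 < π(A) < 1`);
  **`tauInt_setACF_le`** — `τ_int(1_A) ≤ 1/2 + (1 − ε)/(ε (1 − π(A)))`, with the series behind
  `Scoring.tauInt` genuinely summable (`summable_setACF_succ`): every event — a topological sector,
  a plaquette bin — has a FINITE integrated autocorrelation time bounded by the Doeblin constant.
* `heatBathSweep_tauInt_setACF_le` — the heat-bath-sweep instance (`ε = (m/M)^{|l|}`).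

The bound is qualitative (the Doeblin `ε` of a real lattice is astronomically small); the measured
`τ_int(Q)` of the scorers remains the figure of merit.  NOT CLAIMED: general observables (see
`DoeblinObservables.lean` for the transfer to `[0,1]`-valued ones), lower bounds, HMC / flows.
-/

namespace Summit.Ventures.LatticeQCDFlow.Exactness

open MeasureTheory ProbabilityTheory Set
open Summit.Ventures.LatticeQCDFlow.Scoring
open scoped ENNReal

section TauInt

variable {Ω : Type*} [MeasurableSpace Ω] {κ : Kernel Ω Ω} [IsMarkovKernel κ] {ν : Measure Ω}
  [IsProbabilityMeasure ν] {ε : ℝ≥0∞} {π : Measure Ω} [IsProbabilityMeasure π]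

omit [IsMarkovKernel κ] [IsProbabilityMeasure π] in
/-- At lag `0` the two-time law is the diagonal push-forward: `C_0(A, A) = π(A) − π(A)² = π(A)(1 − π(A))`. -/
theorem setAutocov_zero [IsFiniteMeasure π] {A : Set Ω} (hA : MeasurableSet A) :
    setAutocov κ π 0 A A = π.real A * (1 - π.real A) := by
  rw [setAutocov, nHit_zero, Measure.compProd_apply_prod hA hA]
  have h : ∫⁻ x in A, (Kernel.id : Kernel Ω Ω) x A ∂π = π A := by
    have hone : EqOn (fun x => (Kernel.id : Kernel Ω Ω) x A) (fun _ => 1) A := fun x hx => by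
      simp only [Kernel.id_apply, Measure.dirac_apply' _ hA, Set.indicator_of_mem hx, Pi.one_apply]
    rw [setLIntegral_congr_fun hA hone, setLIntegral_one]
  rw [h, ← measureReal_def]
  ring

variable (κ π) in
/-- The normalised autocorrelation function of the indicator of an event for the chain in
equilibrium: `ρ_A(t) = C_t(A, A)/C_0(A, A)` (what the scorers estimate for a sector indicator). -/
noncomputable def setACF (A : Set Ω) (t : ℕ) : ℝ :=
  setAutocov κ π t A A / setAutocov κ π 0 A A

omit [IsMarkovKernel κ] in
/-- `ρ_A(0) = 1` for a non-trivial event. -/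
theorem setACF_zero {A : Set Ω} (hA : MeasurableSet A) (h0 : 0 < π.real A) (h1 : π.real A < 1) :
    setACF κ π A 0 = 1 := by
  rw [setACF, div_self]
  rw [setAutocov_zero hA]
  exact (mul_pos h0 (sub_pos.2 h1)).ne'

/-- **Geometric envelope of the event autocorrelation**: `|ρ_A(t)| ≤ (1 − ε)ᵗ/(1 − π(A))`. -/
theorem abs_setACF_le (hmin : ∀ x {B : Set Ω}, MeasurableSet B → ε * ν B ≤ κ x B) (hε1 : ε ≤ 1)
    (hπ : Kernel.Invariant κ π) {A : Set Ω} (hA : MeasurableSet A) (h0 : 0 < π.real A)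
    (h1 : π.real A < 1) (t : ℕ) :
    |setACF κ π A t| ≤ (1 - ε.toReal) ^ t / (1 - π.real A) := by
  have hpos : 0 < π.real A * (1 - π.real A) := mul_pos h0 (sub_pos.2 h1)
  rw [setACF, setAutocov_zero hA, abs_div, abs_of_pos hpos]
  calc |setAutocov κ π t A A| / (π.real A * (1 - π.real A))
      ≤ π.real A * (1 - ε.toReal) ^ t / (π.real A * (1 - π.real A)) :=
        div_le_div_of_nonneg_right (abs_setAutocov_le hmin hε1 hπ t hA hA) hpos.le
    _ = (1 - ε.toReal) ^ t / (1 - π.real A) := mul_div_mul_left _ _ h0.ne'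

/-- The tail `t ↦ ρ_A(t+1)` is absolutely summable (so `Scoring.tauInt` is a genuine sum here). -/
theorem summable_setACF_succ (hmin : ∀ x {B : Set Ω}, MeasurableSet B → ε * ν B ≤ κ x B)
    (hε0 : 0 < ε) (hε1 : ε ≤ 1) (hπ : Kernel.Invariant κ π) {A : Set Ω} (hA : MeasurableSet A)
    (h0 : 0 < π.real A) (h1 : π.real A < 1) :
    Summable fun t => setACF κ π A (t + 1) := by
  have hεtop : ε ≠ ∞ := ne_top_of_le_ne_top ENNReal.one_ne_top hε1
  have hr0 : 0 ≤ 1 - ε.toReal :=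
    sub_nonneg.2 (ENNReal.toReal_le_of_le_ofReal zero_le_one (by simpa using hε1))
  have hr1 : 1 - ε.toReal < 1 := sub_lt_self _ (ENNReal.toReal_pos hε0.ne' hεtop)
  have habs : |1 - ε.toReal| < 1 := by rw [abs_of_nonneg hr0]; exact hr1
  refine Summable.of_norm_bounded (((hasSum_geometric_succ habs).summable).mul_left (1 - π.real A)⁻¹)
    fun t => ?_
  rw [Real.norm_eq_abs]
  calc |setACF κ π A (t + 1)| ≤ (1 - ε.toReal) ^ (t + 1) / (1 - π.real A) :=
        abs_setACF_le hmin hε1 hπ hA h0 h1 (t + 1)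
    _ = (1 - π.real A)⁻¹ * (1 - ε.toReal) ^ (t + 1) := by rw [div_eq_inv_mul]

/-- **Every event has a finite integrated autocorrelation time under a Doeblin chain**, in the
scorers' convention: `τ_int(1_A) = 1/2 + Σ_{t≥1} ρ_A(t) ≤ 1/2 + (1 − ε)/(ε (1 − π(A)))`. -/
theorem tauInt_setACF_le (hmin : ∀ x {B : Set Ω}, MeasurableSet B → ε * ν B ≤ κ x B)
    (hε0 : 0 < ε) (hε1 : ε ≤ 1) (hπ : Kernel.Invariant κ π) {A : Set Ω} (hA : MeasurableSet A)
    (h0 : 0 < π.real A) (h1 : π.real A < 1) :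
    tauInt (setACF κ π A) ≤ 1 / 2 + (1 - ε.toReal) / (ε.toReal * (1 - π.real A)) := by
  have hεtop : ε ≠ ∞ := ne_top_of_le_ne_top ENNReal.one_ne_top hε1
  have hεpos : 0 < ε.toReal := ENNReal.toReal_pos hε0.ne' hεtop
  have hr0 : 0 ≤ 1 - ε.toReal :=
    sub_nonneg.2 (ENNReal.toReal_le_of_le_ofReal zero_le_one (by simpa using hε1))
  have hr1 : 1 - ε.toReal < 1 := sub_lt_self _ hεpos
  have habs : |1 - ε.toReal| < 1 := by rw [abs_of_nonneg hr0]; exact hr1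
  have hgeom : HasSum (fun t : ℕ => (1 - π.real A)⁻¹ * (1 - ε.toReal) ^ (t + 1))
      ((1 - π.real A)⁻¹ * ((1 - ε.toReal) / (1 - (1 - ε.toReal)))) :=
    (hasSum_geometric_succ habs).mul_left _
  have hle : ∀ t, setACF κ π A (t + 1) ≤ (1 - π.real A)⁻¹ * (1 - ε.toReal) ^ (t + 1) := fun t =>
    calc setACF κ π A (t + 1) ≤ |setACF κ π A (t + 1)| := le_abs_self _
      _ ≤ (1 - ε.toReal) ^ (t + 1) / (1 - π.real A) := abs_setACF_le hmin hε1 hπ hA h0 h1 (t + 1)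
      _ = (1 - π.real A)⁻¹ * (1 - ε.toReal) ^ (t + 1) := by rw [div_eq_inv_mul]
  have hsum := Summable.tsum_le_tsum hle (summable_setACF_succ hmin hε0 hε1 hπ hA h0 h1) hgeom.summable
  rw [hgeom.tsum_eq, sub_sub_cancel] at hsum
  unfold tauInt
  calc 1 / 2 + ∑' t, setACF κ π A (t + 1)
      ≤ 1 / 2 + (1 - π.real A)⁻¹ * ((1 - ε.toReal) / ε.toReal) := by linarith
    _ = 1 / 2 + (1 - ε.toReal) / (ε.toReal * (1 - π.real A)) := by
        have h1' : (1 - π.real A) ≠ 0 := (sub_pos.2 h1).ne'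
        field_simp

end TauInt

section HeatBath

variable {ι : Type*} [Fintype ι] [DecidableEq ι] {X : ι → Type*} [∀ i, MeasurableSpace (X i)]
variable {μ : Π i, Measure (X i)} [∀ i, IsProbabilityMeasure (μ i)] {p : (Π j, X j) → ℝ≥0∞}
variable {m M : ℝ≥0∞}

/-- **Heat-bath sweep**: every event of the Gibbs law has `τ_int ≤ 1/2 + (1 − ε)/(ε(1 − π(A)))` with
`ε = (m/M)^{|l|}`, for the scan over any list `l` through every site and density `m ≤ p ≤ M`. -/
theorem heatBathSweep_tauInt_setACF_le (hp : Measurable p) (hm0 : m ≠ 0) (hMtop : M ≠ ∞)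
    (hmp : ∀ ω, m ≤ p ω) (hpM : ∀ ω, p ω ≤ M) {l : List ι} (hl : ∀ i, i ∈ l) {A : Set (Π j, X j)}
    (hA : MeasurableSet A) (h0 : 0 < (piGibbsLaw μ p).real A) (h1 : (piGibbsLaw μ p).real A < 1) :
    tauInt (setACF (cycle (l.map (siteHeatBath μ p))) (piGibbsLaw μ p) A) ≤
      1 / 2 + (1 - (m.toReal / M.toReal) ^ l.length) /
        ((m.toReal / M.toReal) ^ l.length * (1 - (piGibbsLaw μ p).real A)) := by
  haveI := isMarkovKernel_heatBathSweep (μ := μ) hp hm0 hMtop hmp hpM l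
  haveI := isProbabilityMeasure_piGibbsLaw (μ := μ) (p := p) hm0 hMtop hmp hpM
  haveI : ∀ i, Nonempty (X i) := fun i => nonempty_of_isProbabilityMeasure (μ i)
  have hmin : ∀ x {B : Set (Π j, X j)}, MeasurableSet B →
      (m * M⁻¹) ^ l.length * Measure.pi μ B ≤ cycle (l.map (siteHeatBath μ p)) x B := fun x B hB => by
    have h := Measure.le_iff.1 (heatBathSweep_minorised (μ := μ) hp hm0 hMtop hmp hpM hl x) B hB
    rwa [Measure.smul_apply, smul_eq_mul] at h
  obtain ⟨ω'⟩ := (inferInstance : Nonempty (Π j, X j))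
  have hmM : m ≤ M := (hmp ω').trans (hpM ω')
  have hε1 : (m * M⁻¹) ^ l.length ≤ 1 := by
    refine pow_le_one₀ bot_le ?_
    calc m * M⁻¹ ≤ M * M⁻¹ := mul_le_mul' hmM le_rfl
      _ ≤ 1 := ENNReal.mul_inv_le_one M
  have hε0 : 0 < (m * M⁻¹) ^ l.length :=
    pos_iff_ne_zero.2 (pow_ne_zero _ (mul_ne_zero hm0 (ENNReal.inv_ne_zero.2 hMtop)))
  have h := tauInt_setACF_le hmin hε0 hε1 (heatBathSweep_invariant_piGibbsLaw (μ := μ) hp hm0 hMtop hmp hpM l)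
    hA h0 h1
  rwa [ENNReal.toReal_pow, ENNReal.toReal_mul, ENNReal.toReal_inv, ← div_eq_mul_inv] at h

end HeatBath

end Summit.Ventures.LatticeQCDFlow.Exactness
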